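import Mathlib.Analysis.SpecialFunctions.Trigonometric.Bounds
import Mathlib.Analysis.SpecialFunctions.Trigonometric.Deriv
import Mathlib.Analysis.Calculus.Deriv.MeanValue
import HarnessLib

/-!
# THETA tier-2 kernel checker — LEMMA S: the real-analysis facts behind `ThetaTier2.sinSup` (cc-s2-1, WEIL typing lane; RH-FREE)

The tier-2 cellwise envelope (THETA-CERT-cc6 §E, E1/E3) needs a certified `sup_{θ ∈ [lo, hi]} |sin θ|`; the checker `ThetaTier2Check.sinSup`
returns `1` when the cell may contain a point of `π/2 + πℤ` (or is `≥ π/2` long) and otherwise the larger endpoint bound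
`P₅(d) = d − d³/6 + d⁵/120` at an upper bound `d ≤ 79/50` of the distance to `πℤ` (HOME/cc-s2-1/gen22/TIER2-KERNEL-SPEC.md §2 LEMMA S).
This file proves the three real facts this rests on, with no reference to the checker (so it lands independently of its olean):

* `Real.sin_le_quintic` : `0 ≤ x → sin x ≤ x − x³/6 + x⁵/120` (via `cos_le_quartic` : `cos x ≤ 1 − x²/2 + x⁴/24`, both by the
  derivative template of Mathlib's `Real.sin_gt_sub_cube`);
* `quintic_monotoneOn` : `P₅` is monotone on `[0, 79/50]` (its derivative `1 − x²/2 + x⁴/24 > 0` there — the reason for the cut `79/50`),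
  hence `one_le_quintic` on `[π/2, 79/50]` and `abs_sin_le_quintic_of_dist` : `|θ − nπ| ≤ d ≤ 79/50 → |sin θ| ≤ P₅(d)`;
* `abs_sin_le_max_of_no_crit` : if no point `(n + ½)π` lies in `[lo, hi]` then `|sin θ| ≤ max |sin lo| |sin hi|` for every
  `θ ∈ [lo, hi]` (sin is monotone between consecutive critical points).

Nothing here bears on the truth of RH.
-/

set_option linter.dupNamespace false  -- the mandated namespace repeats `RiemannHypothesis`
set_option autoImplicit false

namespace Summit.RiemannHypothesis.RiemannHypothesis.Theorems.ThetaTier2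

open Real Set

/-! ## Taylor-type one-sided bounds on `[0, ∞)` -/

/-- `cos x ≤ 1 − x²/2 + x⁴/24` for `x ≥ 0` (alternating Taylor bound). [folklore; derivative template of Mathlib `Real.sin_gt_sub_cube`] -/
theorem cos_le_quartic {x : ℝ} (hx : 0 ≤ x) : cos x ≤ 1 - x ^ 2 / 2 + x ^ 4 / 24 := by
  let f (t : ℝ) : ℝ := (1 - t ^ 2 / 2 + t ^ 4 / 24) - cos t
  have hderiv (t : ℝ) : deriv f t = sin t - (t - t ^ 3 / 6) := by
    simp (disch := fun_prop) [f]
    ring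
  have hmono : MonotoneOn f (Ici 0) := by
    apply monotoneOn_of_deriv_nonneg (convex_Ici 0) (by fun_prop) (by fun_prop)
    intro t ht
    rw [interior_Ici] at ht
    rw [hderiv]
    linarith [sin_ge_sub_cube (le_of_lt ht)]
  have h0 : f 0 ≤ f x := hmono (by simp) (by simpa using hx) hx
  simp only [f, cos_zero] at h0
  norm_num at h0
  linarith

/-- `sin x ≤ x − x³/6 + x⁵/120` for `x ≥ 0` (alternating Taylor bound; `P₅ ≥ sin`). [folklore] -/
theorem sin_le_quintic {x : ℝ} (hx : 0 ≤ x) : sin x ≤ x - x ^ 3 / 6 + x ^ 5 / 120 := by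
  let f (t : ℝ) : ℝ := (t - t ^ 3 / 6 + t ^ 5 / 120) - sin t
  have hderiv (t : ℝ) : deriv f t = (1 - t ^ 2 / 2 + t ^ 4 / 24) - cos t := by
    simp (disch := fun_prop) [f]
    ring
  have hmono : MonotoneOn f (Ici 0) := by
    apply monotoneOn_of_deriv_nonneg (convex_Ici 0) (by fun_prop) (by fun_prop)
    intro t ht
    rw [interior_Ici] at ht
    rw [hderiv]
    linarith [cos_le_quartic (le_of_lt ht)]
  have h0 : f 0 ≤ f x := hmono (by simp) (by simpa using hx) hx
  simp only [f, sin_zero] at h0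
  norm_num at h0
  linarith

/-! ## `P₅` is increasing up to `79/50` -/

/-- `P₅(x) = x − x³/6 + x⁵/120` is monotone on `[0, 79/50]`: `P₅′ = 1 − x²/2 + x⁴/24 = ((x²−6)² − 12)/24 > 0` while `x² ≤ 6 − √12`.
[this cell, TIER2-KERNEL-SPEC §2 LEMMA S] -/
theorem quintic_monotoneOn : MonotoneOn (fun x : ℝ => x - x ^ 3 / 6 + x ^ 5 / 120) (Icc 0 (79 / 50)) := by
  have hderiv (t : ℝ) : deriv (fun x : ℝ => x - x ^ 3 / 6 + x ^ 5 / 120) t = 1 - t ^ 2 / 2 + t ^ 4 / 24 := by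
    simp (disch := fun_prop)
    ring
  apply monotoneOn_of_deriv_nonneg (convex_Icc 0 (79 / 50)) (by fun_prop) (by fun_prop)
  intro t ht
  rw [interior_Icc] at ht
  rw [hderiv]
  have h1 : t ^ 2 ≤ (79 / 50) ^ 2 := by nlinarith [ht.1, ht.2]
  have h2 : (7 / 2 : ℝ) ≤ 6 - t ^ 2 := by nlinarith
  nlinarith [mul_le_mul h2 h2 (by norm_num) (by linarith)]

/-- Hence `1 ≤ P₅(d)` for `π/2 ≤ d ≤ 79/50` (`1 = sin(π/2) ≤ P₅(π/2) ≤ P₅(d)`). [this cell] -/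
theorem one_le_quintic {d : ℝ} (h1 : π / 2 ≤ d) (h2 : d ≤ 79 / 50) : 1 ≤ d - d ^ 3 / 6 + d ^ 5 / 120 := by
  have hp : 0 ≤ π / 2 := by positivity
  have ha : π / 2 - (π / 2) ^ 3 / 6 + (π / 2) ^ 5 / 120 ≤ d - d ^ 3 / 6 + d ^ 5 / 120 :=
    quintic_monotoneOn ⟨hp, h1.trans h2⟩ ⟨hp.trans h1, h2⟩ h1
  have hb := sin_le_quintic hp
  rw [sin_pi_div_two] at hb
  linarith

/-! ## Distance to `πℤ` -/

/-- `|sin |e|| = |sin e|`. [folklore] -/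
theorem abs_sin_abs (e : ℝ) : |sin (|e|)| = |sin e| := by
  rcases le_total 0 e with h | h
  · rw [abs_of_nonneg h]
  · rw [abs_of_nonpos h, sin_neg, abs_neg]

/-- **`|sin θ| ≤ P₅(d)` whenever `|θ − nπ| ≤ d ≤ 79/50` for some integer `n`.** [this cell, TIER2-KERNEL-SPEC §2 LEMMA S] -/
theorem abs_sin_le_quintic_of_dist {θ d : ℝ} (n : ℤ) (hd : |θ - n * π| ≤ d) (h2 : d ≤ 79 / 50) :
    |sin θ| ≤ d - d ^ 3 / 6 + d ^ 5 / 120 := by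
  set e := θ - n * π with he
  have hθ : θ = e + n * π := by rw [he]; ring
  have h1 : |sin θ| = |sin (|e|)| := by
    rw [hθ, sin_add_int_mul_pi, abs_mul, abs_neg_one_zpow, one_mul, abs_sin_abs]
  rw [h1]
  have ha0 : 0 ≤ |e| := abs_nonneg e
  have hd0 : 0 ≤ d := ha0.trans hd
  rcases le_or_gt d (π / 2) with hsmall | hbig
  · -- monotone branch: |e| ≤ d ≤ π/2
    have hs0 : 0 ≤ sin |e| := sin_nonneg_of_nonneg_of_le_pi ha0 (by linarith [pi_pos])
    rw [abs_of_nonneg hs0]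
    have hmono : sin |e| ≤ sin d :=
      strictMonoOn_sin.monotoneOn ⟨by linarith [pi_pos], hd.trans hsmall⟩ ⟨by linarith [pi_pos], hsmall⟩ hd
    exact hmono.trans (sin_le_quintic hd0)
  · exact (abs_sin_le_one _).trans (one_le_quintic hbig.le h2)

/-! ## No critical point inside ⇒ the sup is at an endpoint -/

/-- **Endpoint lemma.** If no point `(n + ½)π` (`n ∈ ℤ`) lies in `[lo, hi]`, then `|sin θ| ≤ max |sin lo| |sin hi|` for every
`θ ∈ [lo, hi]`: all three points lie strictly between two consecutive critical points of `sin`, where `sin` is monotone.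
[this cell, TIER2-KERNEL-SPEC §2 LEMMA S] -/
theorem abs_sin_le_max_of_no_crit {lo hi θ : ℝ} (hlo : lo ≤ θ) (hhi : θ ≤ hi)
    (h : ∀ n : ℤ, (n + 1 / 2) * π < lo ∨ hi < (n + 1 / 2) * π) :
    |sin θ| ≤ max |sin lo| |sin hi| := by
  -- m = ⌊θ/π + 1/2⌋: (m − ½)π ≤ θ < (m + ½)π
  set m : ℤ := ⌊θ / π + 1 / 2⌋ with hm
  have hπ := pi_pos
  have hfl : (m : ℝ) ≤ θ / π + 1 / 2 := Int.floor_le _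
  have hlt : θ / π + 1 / 2 < m + 1 := Int.lt_floor_add_one _
  have hA : ((m : ℝ) - 1 / 2) * π ≤ θ := by
    have : ((m : ℝ) - 1 / 2) ≤ θ / π := by linarith
    calc ((m : ℝ) - 1 / 2) * π ≤ θ / π * π := mul_le_mul_of_nonneg_right this hπ.le
      _ = θ := div_mul_cancel₀ θ hπ.ne'
  have hB : θ < ((m : ℝ) + 1 / 2) * π := by
    have : θ / π < (m : ℝ) + 1 / 2 := by linarith
    calc θ = θ / π * π := (div_mul_cancel₀ θ hπ.ne').symm
      _ < ((m : ℝ) + 1 / 2) * π := mul_lt_mul_of_pos_right this hπ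
  -- the lower critical point (m−1+½)π is < lo, the upper one (m+½)π is > hi
  have hlo' : ((m : ℝ) - 1 / 2) * π < lo := by
    rcases h (m - 1) with h1 | h1
    · push_cast at h1; linarith
    · push_cast at h1; linarith
  have hhi' : hi < ((m : ℝ) + 1 / 2) * π := by
    rcases h m with h1 | h1
    · linarith
    · exact h1
  -- shift by mπ into (−π/2, π/2)
  have key : ∀ x : ℝ, sin x = (-1 : ℝ) ^ m * sin (x - m * π) := by
    intro x
    have : x = (x - m * π) + m * π := by ring
    conv_lhs => rw [this, sin_add_int_mul_pi]
  have hu : -(π / 2) ≤ lo - m * π := by nlinarith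
  have hw : hi - m * π ≤ π / 2 := by nlinarith
  have h1 : sin (lo - m * π) ≤ sin (θ - m * π) :=
    strictMonoOn_sin.monotoneOn ⟨hu, by linarith⟩ ⟨by linarith, by linarith⟩ (by linarith)
  have h2 : sin (θ - m * π) ≤ sin (hi - m * π) :=
    strictMonoOn_sin.monotoneOn ⟨by linarith, by linarith⟩ ⟨by linarith, hw⟩ (by linarith)
  have habs : ∀ x : ℝ, |sin x| = |sin (x - m * π)| := by
    intro x; rw [key x, abs_mul, abs_neg_one_zpow, one_mul]
  rw [habs θ, habs lo, habs hi]
  exact abs_le_max_abs_abs h1 h2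

end Summit.RiemannHypothesis.RiemannHypothesis.Theorems.ThetaTier2
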